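import Mathlib.FieldTheory.IsAlgClosed.Basic
import Mathlib.Algebra.Polynomial.Roots
import Literature.AnabelianGeometry.EtaleTheta.Setting
import Literature.AnabelianGeometry.EtaleTheta.SettingGalois
import HarnessLib

/-!
# [EtTh] §1 setting: the printed properties of `G_{K_N}`, `G_{J_N}`, `G_K̈`, `G_{J̈_N}` as theorems

Mochizuki, *The étale theta function and its Frobenioid-theoretic manifestations*, Publ. RIMS **45**
(2009), §1, PRIMS PDF pp. 13–14, 17, 19 (printed 239–240, 243, 245)
[cite: MochizukiEtTh2009, §1 p.13].

In the [EtTh] §1 root `EtaleTheta/Setting.lean` (v3, seat abc-iut-L2-t1) the fields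
"`K_N := K(ζ_N, q_X^{1/N}) ⊆ K̄`" (p. 13), "`J_N := K_N(a^{1/N})_{a ∈ K_N}`" (p. 14),
"`K̈ := K₂`", "`J̈_N := K̈_N(a^{1/N})_{a ∈ K̈_N}`, `K̈_N := K_{2N}`" (p. 17) are honest subfields of
`ℚ̄_p` (`fieldKN`, `fieldJN`, `fieldJddN`, over the tree interface `SemiGraphs.TemperedCurve p`) and
their absolute Galois groups `ThetaSetting.GKN/GJN/GKdd/GJddN` are fixing subgroups `≤ G_{ℚ_p}`. The
properties that v2 of the root had to TRANSCRIBE as axioms are therefore THEOREMS; this file (cell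
abc-iut, unit W2-L2-03 re-pointed, ruling R-7 (b)/(c)) proves them:

* `GKN_le_GK`, `GJN_le_GKN`, `GJddN_le_GKddN`, `GJddN_le_GJN` — the towers `K ⊆ K_N ⊆ J_N`,
  `K̈_N = K_{2N} ⊆ J̈_N`, "`J_N ⊆ J̈_N`" (p. 17);
* `GKN_one` — `K₁ = K`; `GKN_anti` — "`Y_M → Y` may be regarded as a subcovering of `Y_N → Y`"
  for `M ∣ N` (p. 19) on the field side: `K_M ⊆ K_N` (every `M`-th root of `q` is an `N`-th root of
  `q` times a root of unity, `ℚ̄_p` being algebraically closed);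
* `isOpen_GKN` / `isClosed_GKN` — `K_N/K` is finite (finitely many roots adjoined to the finite
  extension `K/ℚ_p`);
* `GKN_normal`, `GJN_normal`, `GJddN_normal` — `G_{K_N}, G_{J_N}, G_{J̈_N} ⊴ G_K`: the text forms
  "`Gal(K_N/K)`" (p. 13), "`Gal(J_N/K_N)`" (p. 14); proved WITHOUT Galois theory of Kummer
  extensions: an element of `G_K` permutes the `N`-th roots of unity and of `q_X ∈ K`, hence
  stabilises `K_N` (and then `J_N`, `J̈_N`) as a set, and the fixing subgroup of a `G_K`-stable
  subfield is normal in `G_K` (`SettingGalois`-style lemma `normal_subgroupOf_fixingSubgroup_of_map_le`);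
* `Kdd_eq_restrictScalars_adjoin_sqrt`, `relIndex_GKdd_le_two`, `GKdd_normal` — `K̈ = K(q_X^{1/2})`,
  `[G_K : G_K̈] ≤ 2`.
NOT proved here (genuine arithmetic of `p`-adic fields, not Galois plumbing): finiteness of `J_N/K_N`
(`K_N^×/(K_N^×)^N` finite), `[K_N : K]`-formulas, `Δ`-side statements. Nothing asserts that a
`ThetaSetting p` exists; typed ≠ endorsed; no side is taken on any disputed claim.
-/

noncomputable section

namespace Literature.AnabelianGeometry.EtaleTheta

open Literature.AnabelianGeometry.SemiGraphs IntermediateField Polynomial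

variable {p : ℕ} [Fact p.Prime]

/-! ### A normality criterion (pure Galois plumbing) -/

namespace SettingGalois

variable {k E : Type*} [Field k] [Field E] [Algebra k E]

/-- If every element of `G_K` maps the subfield `L` into itself, then `G_L ⊴ G_K` (fixing subgroups
inside `Gal(E/k)`; no hypothesis `K ≤ L` or finiteness needed): for `τ ∈ G_L`, `σ ∈ G_K`, `x ∈ L` one
has `σ τ σ⁻¹ x = σ (τ (σ⁻¹ x)) = x` because `σ⁻¹ x ∈ L`. Used for `K_N`, `J_N`, `J̈_N`, which are
`G_K`-stable by construction ([EtTh] p. 13 "`Gal(K_N/K)`"). [cite: MochizukiEtTh2009, §1 p.13] -/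
theorem normal_subgroupOf_fixingSubgroup_of_map_le {K L : IntermediateField k E}
    (h : ∀ σ : Gal(E/k), σ ∈ K.fixingSubgroup → L.map (σ : E →ₐ[k] E) ≤ L) :
    (L.fixingSubgroup.subgroupOf K.fixingSubgroup).Normal := by
  refine ⟨fun τ hτ σ => ?_⟩
  rw [Subgroup.mem_subgroupOf, IntermediateField.mem_fixingSubgroup_iff] at hτ ⊢
  intro x hx
  have hσinv : (σ⁻¹ : K.fixingSubgroup).1 ∈ K.fixingSubgroup := (σ⁻¹).2
  have hx' : ((σ : Gal(E/k))⁻¹ : Gal(E/k)) x ∈ L :=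
    h _ hσinv ⟨x, hx, rfl⟩
  have := hτ _ hx'
  change ((σ : Gal(E/k)) * (τ : Gal(E/k)) * (σ : Gal(E/k))⁻¹) x = x
  rw [AlgEquiv.mul_apply, AlgEquiv.mul_apply, this, ← AlgEquiv.mul_apply, mul_inv_cancel,
    AlgEquiv.one_apply]

end SettingGalois

/-! ### The fields `K_N`, `J_N`, `J̈_N`: inclusions, finiteness, stability under `G_K` -/

section Fields

variable (K : IntermediateField ℚ_[p] (PadicAlgCl p)) (q : PadicAlgCl p)

/-- `K ⊆ K_N` (p. 13). [cite: MochizukiEtTh2009, §1 p.13] -/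
theorem le_fieldKN (N : ℕ+) : K ≤ fieldKN K q N :=
  fun _ hx => subset_adjoin ℚ_[p] _ (Set.mem_union_left _ hx)

/-- An `N`-th root of unity lies in `K_N = K(ζ_N, q^{1/N})` (p. 13). [cite: MochizukiEtTh2009, §1 p.13] -/
theorem mem_fieldKN_of_pow_eq_one {N : ℕ+} {x : PadicAlgCl p} (hx : x ^ (N : ℕ) = 1) :
    x ∈ fieldKN K q N :=
  subset_adjoin ℚ_[p] _ (Set.mem_union_right _ (Or.inl hx))

/-- An `N`-th root of `q` lies in `K_N = K(ζ_N, q^{1/N})` (p. 13). [cite: MochizukiEtTh2009, §1 p.13] -/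
theorem mem_fieldKN_of_pow_eq {N : ℕ+} {x : PadicAlgCl p} (hx : x ^ (N : ℕ) = q) :
    x ∈ fieldKN K q N :=
  subset_adjoin ℚ_[p] _ (Set.mem_union_right _ (Or.inr hx))

/-- `K₁ = K` when `q ∈ K` (p. 14: "`Y = Y₁`", `K = K₁`). [cite: MochizukiEtTh2009, §1 p.14] -/
theorem fieldKN_one (hq : q ∈ K) : fieldKN K q 1 = K := by
  refine le_antisymm ?_ (le_fieldKN K q 1)
  change adjoin ℚ_[p] _ ≤ K
  rw [adjoin_le_iff]
  rintro x (hx | hx | hx)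
  · exact hx
  · simp only [PNat.one_coe, pow_one] at hx
    rw [hx]; exact one_mem K
  · simp only [PNat.one_coe, pow_one] at hx
    rw [hx]; exact hq

/-- `K_M ⊆ K_N` for `M ∣ N` (p. 19: "`Y_M → Y` may be regarded as a subcovering of `Y_N → Y`"): an
`M`-th root of unity is an `N`-th root of unity, and an `M`-th root `x` of `q` is `(x/y^{N/M}) · y^{N/M}`
for any `N`-th root `y` of `q` (which exists, `ℚ̄_p` being algebraically closed), where `x/y^{N/M}` is
an `M`-th, hence `N`-th, root of unity. [cite: MochizukiEtTh2009, §1 p.19] -/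
theorem fieldKN_mono {M N : ℕ+} (hMN : (M : ℕ) ∣ N) : fieldKN K q M ≤ fieldKN K q N := by
  obtain ⟨d, hd⟩ := hMN
  change adjoin ℚ_[p] _ ≤ fieldKN K q N
  rw [adjoin_le_iff]
  rintro x (hx | hx | hx)
  · exact le_fieldKN K q N hx
  · exact mem_fieldKN_of_pow_eq_one K q (by rw [hd, pow_mul, hx, one_pow])
  · -- `x ^ M = q`; pick `y` with `y ^ N = q`
    obtain ⟨y, hy⟩ := IsAlgClosed.exists_pow_nat_eq q N.pos
    by_cases hq0 : q = 0
    · have hx0 : x = 0 := by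
        rw [hq0] at hx
        exact eq_zero_of_pow_eq_zero hx
      rw [hx0]; exact zero_mem _
    have hyd : (y ^ d) ^ (M : ℕ) = q := by rw [← pow_mul, mul_comm, ← hd, hy]
    have hy0 : y ^ d ≠ 0 := by
      intro h; apply hq0; rw [← hyd, h, zero_pow (PNat.ne_zero M)]
    have hu : (x / y ^ d) ^ (N : ℕ) = 1 := by
      rw [hd, pow_mul, div_pow, hx, hyd, div_self hq0, one_pow]
    have hmem : x / y ^ d * y ^ d ∈ fieldKN K q N :=
      mul_mem (mem_fieldKN_of_pow_eq_one K q hu)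
        (pow_mem (mem_fieldKN_of_pow_eq K q hy) d)
    rwa [div_mul_cancel₀ x hy0] at hmem

/-- `K_N ⊆ J_N` (p. 14). [cite: MochizukiEtTh2009, §1 p.14] -/
theorem fieldKN_le_fieldJN (N : ℕ+) : fieldKN K q N ≤ fieldJN K q N :=
  fun _ hx => subset_adjoin ℚ_[p] _ (Set.mem_union_left _ hx)

/-- `K̈_N = K_{2N} ⊆ J̈_N` (p. 17). [cite: MochizukiEtTh2009, §1 p.17] -/
theorem fieldKN_two_mul_le_fieldJddN (N : ℕ+) : fieldKN K q (2 * N) ≤ fieldJddN K q N :=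
  fun _ hx => subset_adjoin ℚ_[p] _ (Set.mem_union_left _ hx)

/-- "`J_N ⊆ J̈_N`" (p. 17, "since this diagram is cartesian [and `J_N ⊆ J̈_N`]").
[cite: MochizukiEtTh2009, §1 p.17] -/
theorem fieldJN_le_fieldJddN (N : ℕ+) : fieldJN K q N ≤ fieldJddN K q N := by
  have hKK : fieldKN K q N ≤ fieldKN K q (2 * N) :=
    fieldKN_mono K q ⟨2, by simp [mul_comm]⟩
  change adjoin ℚ_[p] _ ≤ fieldJddN K q N
  rw [adjoin_le_iff]
  rintro x (hx | hx)
  · exact fieldKN_two_mul_le_fieldJddN K q N (hKK hx)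
  · exact subset_adjoin ℚ_[p] _ (Set.mem_union_right _ (hKK hx))

/-- The set of `N`-th roots of unity and `N`-th roots of `q` in `ℚ̄_p` is finite (contained in the root
set of `(X^N − 1)(X^N − q)`). [cite: MochizukiEtTh2009, §1 p.13] -/
theorem finite_rootsKN (N : ℕ+) :
    ({x : PadicAlgCl p | x ^ (N : ℕ) = 1 ∨ x ^ (N : ℕ) = q}).Finite := by
  have h1 : ((X ^ (N : ℕ) - C (1 : PadicAlgCl p)) : (PadicAlgCl p)[X]) ≠ 0 :=
    X_pow_sub_C_ne_zero N.pos 1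
  have h2 : ((X ^ (N : ℕ) - C q) : (PadicAlgCl p)[X]) ≠ 0 := X_pow_sub_C_ne_zero N.pos q
  refine (((X ^ (N : ℕ) - C 1) * (X ^ (N : ℕ) - C q)).rootSet_finite (PadicAlgCl p)).subset ?_
  intro x hx
  rw [mem_rootSet]
  refine ⟨mul_ne_zero h1 h2, ?_⟩
  rcases hx with hx | hx
  · simp [hx]
  · simp [hx]

/-- `K_N/ℚ_p` is finite when `K/ℚ_p` is (finitely many algebraic elements adjoined):
`K_N = K ⊔ ℚ_p(roots)`. [cite: MochizukiEtTh2009, §1 p.13] -/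
theorem finiteDimensional_fieldKN [FiniteDimensional ℚ_[p] K] (N : ℕ+) :
    FiniteDimensional ℚ_[p] (fieldKN K q N) := by
  have hfin := finite_rootsKN q N
  haveI : Finite {x : PadicAlgCl p | x ^ (N : ℕ) = 1 ∨ x ^ (N : ℕ) = q} := hfin.to_subtype
  haveI : FiniteDimensional ℚ_[p]
      (adjoin ℚ_[p] {x : PadicAlgCl p | x ^ (N : ℕ) = 1 ∨ x ^ (N : ℕ) = q}) :=
    finiteDimensional_adjoin fun x _ => (Algebra.IsAlgebraic.isAlgebraic x).isIntegral
  have heq : fieldKN K q N =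
      K ⊔ adjoin ℚ_[p] {x : PadicAlgCl p | x ^ (N : ℕ) = 1 ∨ x ^ (N : ℕ) = q} := by
    change adjoin ℚ_[p] _ = _
    rw [adjoin_union, adjoin_self]
  rw [heq]
  infer_instance

/-- `G_K` stabilises `K_N` when `q ∈ K`: an automorphism fixing `K` permutes the `N`-th roots of
unity and the `N`-th roots of `q` ("`Gal(K_N/K)`", p. 13). [cite: MochizukiEtTh2009, §1 p.13] -/
theorem map_fieldKN_le (hq : q ∈ K) (N : ℕ+) (σ : GQp p) (hσ : σ ∈ K.fixingSubgroup) :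
    (fieldKN K q N).map (σ : PadicAlgCl p →ₐ[ℚ_[p]] PadicAlgCl p) ≤ fieldKN K q N := by
  change (adjoin ℚ_[p] _).map _ ≤ _
  rw [adjoin_map]
  refine adjoin.mono ℚ_[p] _ _ ?_
  rw [IntermediateField.mem_fixingSubgroup_iff] at hσ
  rintro _ ⟨x, hx | hx | hx, rfl⟩
  · left
    change σ x ∈ K
    rw [hσ x hx]; exact hx
  · right; left
    change (σ x) ^ (N : ℕ) = 1
    rw [← map_pow, hx, map_one]
  · right; right
    change (σ x) ^ (N : ℕ) = q
    rw [← map_pow, hx, hσ q hq]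

/-- `G_K` stabilises `J_N` when `q ∈ K` (p. 14: `J_N` is canonically attached to `K_N`).
[cite: MochizukiEtTh2009, §1 p.14] -/
theorem map_fieldJN_le (hq : q ∈ K) (N : ℕ+) (σ : GQp p) (hσ : σ ∈ K.fixingSubgroup) :
    (fieldJN K q N).map (σ : PadicAlgCl p →ₐ[ℚ_[p]] PadicAlgCl p) ≤ fieldJN K q N := by
  have hKN := map_fieldKN_le K q hq N σ hσ
  change (adjoin ℚ_[p] _).map _ ≤ _
  rw [adjoin_map]
  refine adjoin.mono ℚ_[p] _ _ ?_
  rintro _ ⟨x, hx | hx, rfl⟩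
  · exact Or.inl (hKN ⟨x, hx, rfl⟩)
  · right
    change (σ x) ^ (N : ℕ) ∈ fieldKN K q N
    rw [← map_pow]
    exact hKN ⟨x ^ (N : ℕ), hx, rfl⟩

/-- `G_K` stabilises `J̈_N` when `q ∈ K` (p. 17). [cite: MochizukiEtTh2009, §1 p.17] -/
theorem map_fieldJddN_le (hq : q ∈ K) (N : ℕ+) (σ : GQp p) (hσ : σ ∈ K.fixingSubgroup) :
    (fieldJddN K q N).map (σ : PadicAlgCl p →ₐ[ℚ_[p]] PadicAlgCl p) ≤ fieldJddN K q N := by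
  have hKN := map_fieldKN_le K q hq (2 * N) σ hσ
  change (adjoin ℚ_[p] _).map _ ≤ _
  rw [adjoin_map]
  refine adjoin.mono ℚ_[p] _ _ ?_
  rintro _ ⟨x, hx | hx, rfl⟩
  · exact Or.inl (hKN ⟨x, hx, rfl⟩)
  · right
    change (σ x) ^ (N : ℕ) ∈ fieldKN K q (2 * N)
    rw [← map_pow]
    exact hKN ⟨x ^ (N : ℕ), hx, rfl⟩

/-- `K₂ = K(s)` for any square root `s` of `q ∈ K` (`K̈ = K₂`, p. 17, with `K_N = K(ζ_N, q_X^{1/N})`,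
p. 13; `ζ₂ = −1 ∈ K`):
the square roots of `1` are `±1 ∈ K` and those of `q` are `±s`. [cite: MochizukiEtTh2009, §1 p.17] -/
theorem fieldKN_two_eq_restrictScalars_adjoin {s : PadicAlgCl p} (hs : s ^ 2 = q) :
    fieldKN K q 2 = restrictScalars ℚ_[p] K⟮s⟯ := by
  refine le_antisymm ?_ ?_
  · change adjoin ℚ_[p] _ ≤ _
    rw [adjoin_le_iff]
    rintro x (hx | hx | hx)
    · exact SettingGalois.le_restrictScalars_adjoin K {s} hx
    · change x ^ 2 = 1 at hx
      rcases eq_or_eq_neg_of_sq_eq_sq x 1 (by rw [hx, one_pow]) with h | h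
      · rw [h]; exact one_mem _
      · rw [h]; exact neg_mem (one_mem _)
    · change x ^ 2 = q at hx
      have hsmem : s ∈ restrictScalars ℚ_[p] K⟮s⟯ := mem_adjoin_simple_self K s
      rcases eq_or_eq_neg_of_sq_eq_sq x s (by rw [hx, hs]) with h | h
      · rw [h]; exact hsmem
      · rw [h]; exact neg_mem hsmem
  · rw [restrictScalars_adjoin, adjoin_le_iff]
    rintro x (hx | hx)
    · exact le_fieldKN K q 2 hx
    · rw [Set.mem_singleton_iff] at hx
      rw [hx]
      exact mem_fieldKN_of_pow_eq K q (N := 2) hs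

end Fields

/-! ### The printed properties of `G_{K_N}`, `G_{J_N}`, `G_K̈`, `G_{J̈_N}` for a `ThetaSetting` -/

namespace ThetaSetting

variable (D : ThetaSetting p)

/-- `G_{K_N} ≤ G_K` (`K ⊆ K_N`, p. 13). [cite: MochizukiEtTh2009, §1 p.13] -/
theorem GKN_le_GK (N : ℕ+) : D.GKN N ≤ D.GK :=
  IntermediateField.fixingSubgroup_le (le_fieldKN D.K D.qX N)

/-- `G_{K₁} = G_K` (`K₁ = K`, p. 14). [cite: MochizukiEtTh2009, §1 p.14] -/
theorem GKN_one : D.GKN 1 = D.GK := by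
  change (fieldKN D.K D.qX 1).fixingSubgroup = D.K.fixingSubgroup
  rw [fieldKN_one D.K D.qX D.qX_mem]

/-- `G_{K_N} ≤ G_{K_M}` for `M ∣ N` (`K_M ⊆ K_N`, p. 19). [cite: MochizukiEtTh2009, §1 p.19] -/
theorem GKN_anti {M N : ℕ+} (hMN : (M : ℕ) ∣ N) : D.GKN N ≤ D.GKN M :=
  IntermediateField.fixingSubgroup_le (fieldKN_mono D.K D.qX hMN)

/-- `G_{K_N}` is open in `G_{ℚ_p}` (`K_N/ℚ_p` finite; p. 13). [cite: MochizukiEtTh2009, §1 p.13] -/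
theorem isOpen_GKN (N : ℕ+) : IsOpen (D.GKN N : Set (GQp p)) := by
  haveI := D.finiteDimensional_K
  haveI := finiteDimensional_fieldKN D.K D.qX N
  exact (fieldKN D.K D.qX N).fixingSubgroup_isOpen

/-- `G_{K_N}` is closed in `G_{ℚ_p}` (p. 13). [cite: MochizukiEtTh2009, §1 p.13] -/
theorem isClosed_GKN (N : ℕ+) : IsClosed (D.GKN N : Set (GQp p)) := by
  haveI := D.finiteDimensional_K
  haveI := finiteDimensional_fieldKN D.K D.qX N
  exact (fieldKN D.K D.qX N).fixingSubgroup_isClosed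

/-- `G_{K_N}` is open in `G_K` (relative form). [cite: MochizukiEtTh2009, §1 p.13] -/
theorem isOpen_GKN_subgroupOf (N : ℕ+) :
    IsOpen (((D.GKN N).subgroupOf D.GK : Subgroup D.GK) : Set D.GK) :=
  Subgroup.subgroupOf_isOpen _ _ (D.isOpen_GKN N)

/-- **`G_{K_N} ⊴ G_K`**: "`Gal(K_N/K)`" (p. 13) — `K_N/K` is Galois; proved via `G_K`-stability of
`K_N = K(all N-th roots of 1 and of q_X)`. [cite: MochizukiEtTh2009, §1 p.13] -/
theorem GKN_normal (N : ℕ+) : ((D.GKN N).subgroupOf D.GK).Normal :=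
  SettingGalois.normal_subgroupOf_fixingSubgroup_of_map_le
    (map_fieldKN_le D.K D.qX D.qX_mem N)

/-- `G_{J_N} ≤ G_{K_N}` (`K_N ⊆ J_N`, p. 14). [cite: MochizukiEtTh2009, §1 p.14] -/
theorem GJN_le_GKN (N : ℕ+) : D.GJN N ≤ D.GKN N :=
  IntermediateField.fixingSubgroup_le (fieldKN_le_fieldJN D.K D.qX N)

/-- `G_{J_N} ⊴ G_K` (`J_N/K` Galois: "a finite Galois extension of `K_N`" canonically attached to the
Galois extension `K_N/K`, p. 14). [cite: MochizukiEtTh2009, §1 p.14] -/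
theorem GJN_normal (N : ℕ+) : ((D.GJN N).subgroupOf D.GK).Normal :=
  SettingGalois.normal_subgroupOf_fixingSubgroup_of_map_le
    (map_fieldJN_le D.K D.qX D.qX_mem N)

/-- `G_{J_N} ⊴ G_{K_N}` ("`Gal(J_N/K_N)`", p. 14). [cite: MochizukiEtTh2009, §1 p.14] -/
theorem GJN_normal_GKN (N : ℕ+) : ((D.GJN N).subgroupOf (D.GKN N)).Normal :=
  SettingGalois.normal_subgroupOf_fixingSubgroup_of_map_le fun σ hσ =>
    map_fieldJN_le D.K D.qX D.qX_mem N σ (D.GKN_le_GK N hσ)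

/-- `G_K̈ = G_{K₂}` (definition, p. 17 "`K̈ = K₂`"). [cite: MochizukiEtTh2009, §1 p.17] -/
theorem GKdd_eq : D.GKdd = D.GKN 2 := rfl

/-- `G_K̈ ≤ G_K` (p. 17). [cite: MochizukiEtTh2009, §1 p.17] -/
theorem GKdd_le_GK : D.GKdd ≤ D.GK := D.GKN_le_GK 2

/-- `G_K̈ ⊴ G_K` (p. 17). [cite: MochizukiEtTh2009, §1 p.17] -/
theorem GKdd_normal : (D.GKdd.subgroupOf D.GK).Normal := D.GKN_normal 2

/-- `G_{K̈_N} = G_{K_{2N}} ≤ G_K̈` (`K̈ = K₂ ⊆ K_{2N}`, p. 17). [cite: MochizukiEtTh2009, §1 p.17] -/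
theorem GKddN_le_GKdd (N : ℕ+) : D.GKddN N ≤ D.GKdd :=
  D.GKN_anti ⟨N, rfl⟩

/-- `G_{J̈_N} ≤ G_{K̈_N}` (`K̈_N ⊆ J̈_N`, p. 17). [cite: MochizukiEtTh2009, §1 p.17] -/
theorem GJddN_le_GKddN (N : ℕ+) : D.GJddN N ≤ D.GKddN N :=
  IntermediateField.fixingSubgroup_le (fieldKN_two_mul_le_fieldJddN D.K D.qX N)

/-- `G_{J̈_N} ≤ G_{J_N}` ("`J_N ⊆ J̈_N`", p. 17). [cite: MochizukiEtTh2009, §1 p.17] -/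
theorem GJddN_le_GJN (N : ℕ+) : D.GJddN N ≤ D.GJN N :=
  IntermediateField.fixingSubgroup_le (fieldJN_le_fieldJddN D.K D.qX N)

/-- `G_{J̈_N} ⊴ G_K` (p. 17). [cite: MochizukiEtTh2009, §1 p.17] -/
theorem GJddN_normal (N : ℕ+) : ((D.GJddN N).subgroupOf D.GK).Normal :=
  SettingGalois.normal_subgroupOf_fixingSubgroup_of_map_le
    (map_fieldJddN_le D.K D.qX D.qX_mem N)

/-- `K̈ = K(q̈)` with `q̈ = q_X^{1/2}` the chosen square root (p. 17). [cite: MochizukiEtTh2009, §1 p.17] -/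
theorem Kdd_eq_restrictScalars_adjoin_sqrt : D.Kdd = restrictScalars ℚ_[p] D.K⟮D.sqrtqX⟯ :=
  fieldKN_two_eq_restrictScalars_adjoin D.K D.qX D.sqrtqX_sq

/-- `[G_K : G_K̈] ≤ 2` (`K̈ = K(q_X^{1/2})`, p. 17). [cite: MochizukiEtTh2009, §1 p.17] -/
theorem relIndex_GKdd_le_two : D.GKdd.relIndex D.GK ≤ 2 := by
  have hs : D.sqrtqX ^ 2 ∈ D.K := by rw [D.sqrtqX_sq]; exact D.qX_mem
  change D.Kdd.fixingSubgroup.relIndex D.K.fixingSubgroup ≤ 2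
  rw [D.Kdd_eq_restrictScalars_adjoin_sqrt]
  exact SettingGalois.relIndex_fixingSubgroup_adjoin_le_two_of_sq_mem D.K hs

/-- `[G_K : G_K̈] ≠ 0`, i.e. `K̈/K` is finite (p. 17). [cite: MochizukiEtTh2009, §1 p.17] -/
theorem relIndex_GKdd_ne_zero : D.GKdd.relIndex D.GK ≠ 0 := by
  have hs : D.sqrtqX ^ 2 ∈ D.K := by rw [D.sqrtqX_sq]; exact D.qX_mem
  change D.Kdd.fixingSubgroup.relIndex D.K.fixingSubgroup ≠ 0
  rw [D.Kdd_eq_restrictScalars_adjoin_sqrt]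
  exact SettingGalois.relIndex_fixingSubgroup_adjoin_ne_zero_of_sq_mem D.K hs

end ThetaSetting

end Literature.AnabelianGeometry.EtaleTheta

end
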